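import Summits.QuantumFields.YangMills.Theorems.UnitScaleTiltFluctuationComparisonRegPrLiftLegsGauge

/-!
# Route `UnitScaleTilt` — crux K1bR-pr `FluctuationComparisonRegPr` (stmt-QuantumFields-19201 → `…L`), stub `stub_oneStepSmallLift`, piece (L2)
# for INTERIOR-SUPPORTED corrections — the Γ-LEG LAYER, file 4: COARSE GAUGE + LINE FUNCTIONAL; `ApproxLiftStep` FROM LEGS
# (support file `--supports stmt-QuantumFields-19201`)

Cell `ym3-torus` (HUMAN RULING D-0037, YM ladder rung R3), seat `ym3-torus-p1` gen 11 (UV side; cell memo HOME/UV3-NODE.md §20).  Files 1–3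
(`…LiftLegsLoops/Avg/Gauge`): for `U⋆ = E · faceSec V` with an ARBITRARY fine correction `E` (`dist1 (E b) ≤ s`), Bałaban's (0.4) average satisfies
`Ū⋆(c) = V(c) + inLin·V(c) + V(c)·outLin + O((ms)²)`, `inLin = stairLin(c₋) + rowInLin`, `outLin = rowOutLin − stairLin(c₊)`, and the staircase
functional exponentiates to a coarse gauge transformation `g_E = legGauge E` with `g_E(y) = 1 + stairLin E y + O((ms)²)`.  Here:

* §1 HEAD THEOREM **`norm_avgFun_mulField_faceSec_sub_gauge_sub_line_le`** (`SU(N)`, printed `exp[mean log]`; `80ms ≤ 1`, `8ms < δ_N`, `N·s < π`,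
  `m = (d+3)L`): `‖Ū⋆(c) − g_E(c₋)·V(c)·g_E(c₊)⁻¹ − (rowInLin E c · V(c) + V(c) · rowOutLin E c)‖ ≤ 477(ms)²` — up to a coarse gauge transformation
  (FREE by `approxLiftStep_of_gauge`, p454916) the accuracy of the lift is the LINE FUNCTIONAL, i.e. GENERALISED S-NEUTRALITY («the signed line
  sums of the correction, in-block part in frame `c₋` plus far part in frame `c₊`, vanish to second order»; for an exit-supported `E` = F2's face mean).
* §2 **`approxLiftStep_of_legs`** (`SU(2)`): a correction recipe `V ↦ E_V` with `PlaqSmall (κ₀δ) (E_V · faceSec V)`, `dist1 (E_V b) ≤ s`, `80ms ≤ 1` and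
  line functional `≤ η′` on `δ`-small `V` gives `ApproxLiftStep P j κ₀ (477(ms)² + η′) δ` — the per-level input of `ApproxSmallLift`
  (`oneStepSmallLift_stub_of_approx`, p454840) for INTERIOR-supported kernels (this lineage's dual Whitney `DualWhitney.Zop`, every odd `L ≥ 5`),
  the analogue of the fleet's face-supported `exists_approxSmallLift_of_kernel` route.

Elementary; nothing of Bałaban's is asserted.
-/

noncomputable section

open scoped BigOperators

namespace Summit.QuantumFields.YangMills.Theorems.ApproxLift

open Literature.MathematicalPhysics.QuantumFieldTheory.Balaban1983to89
open T4Continuum BlockAveraging AveragingRT B10Eq47AxialChi BlockAveragingSection BlockAveragingSectionPlaq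
open NormedSpace ExpMeanLog
open scoped Matrix.Norms.L2Operator

variable {P : Params} {j : ℕ}

section Gauge

variable {n : Type*} [Fintype n] [DecidableEq n] [Nonempty n]

/-- A special unitary matrix has operator norm `≤ 1`. -/
private theorem norm_coe_su_le_one₅ (g : Matrix.specialUnitaryGroup n ℂ) : ‖(g : Matrix n n ℂ)‖ ≤ 1 :=
  (UnitaryModel.norm_of_mem_unitaryGroup (Matrix.specialUnitaryGroup_le_unitaryGroup g.2)).le

variable {E : GaugeField P j (Matrix.specialUnitaryGroup n ℂ)} {s : ℝ}

/-! ## §1 Head theorem: coarse gauge + line functional -/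

/-- **THE (0.4) AVERAGE OF `U⋆ = E · faceSec V` IS, TO SECOND ORDER, THE GAUGE TRANSFORM `V^{g_E}` PLUS THE LINE FUNCTIONAL** (`SU(N)`, printed
`exp[mean log]`, standing range; ARBITRARY correction `E` with `dist1 (E b) ≤ s`, `80ms ≤ 1`, `8ms < δ_N`, `N·s < π`):
`‖Ū⋆(c) − g_E(c₋)·V(c)·g_E(c₊)⁻¹ − (rowInLin E c · V(c) + V(c) · rowOutLin E c)‖ ≤ 477(ms)²`. -/
theorem norm_avgFun_mulField_faceSec_sub_gauge_sub_line_le (hj : j + 1 ≤ P.m + P.K) (hE : ∀ b, dist1 (E b) ≤ s)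
    (hsm : 80 * (legLen P : ℝ) * s ≤ 1) (hδ : 8 * (legLen P : ℝ) * s < deltaSU n) (hπ : Fintype.card n * s < Real.pi)
    (V : GaugeField P (j + 1) (Matrix.specialUnitaryGroup n ℂ)) (c : PBond P (j + 1)) :
    ‖((avgFun (expMeanLogSU (n := n)) (mulField E (faceSec V)) c : Matrix.specialUnitaryGroup n ℂ) : Matrix n n ℂ) -
        ((GaugeField.gaugeAct (legGauge E) V c : Matrix.specialUnitaryGroup n ℂ) : Matrix n n ℂ) -
        (rowInLin E c * (V c : Matrix n n ℂ) + (V c : Matrix n n ℂ) * rowOutLin E c)‖ ≤ 477 * ((legLen P : ℝ) * s) ^ 2 := by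
  set m : ℝ := (legLen P : ℝ) with hm
  have s0 : 0 ≤ s := (GaugeGroup.dist1_nonneg _).trans (hE ⟨emb c.src, c.dir⟩)
  have m1 : (1 : ℝ) ≤ m := by
    have : 1 ≤ legLen P := le_trans P.L_pos (Nat.le_mul_of_pos_left _ (by omega))
    rw [hm]; exact_mod_cast this
  have hs3 : s ≤ 1 / 3 := by nlinarith
  have hms : 2 * (legLen P : ℝ) * s ≤ 1 := by rw [← hm]; nlinarith
  have hlegs := norm_avgFun_mulField_faceSec_sub_legs_le hj hE hsm hδ V c
  obtain ⟨hg, -⟩ := norm_legGauge_sub_le hE hs3 hπ hms c.src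
  obtain ⟨-, hg'⟩ := norm_legGauge_sub_le hE hs3 hπ hms c.tgt
  set Vc : Matrix n n ℂ := ((V c : Matrix.specialUnitaryGroup n ℂ) : Matrix n n ℂ) with hVc
  set G₁ : Matrix n n ℂ := ((legGauge E c.src : Matrix.specialUnitaryGroup n ℂ) : Matrix n n ℂ) with hG₁
  set G₂ : Matrix n n ℂ := (((legGauge E c.tgt)⁻¹ : Matrix.specialUnitaryGroup n ℂ) : Matrix n n ℂ) with hG₂
  set φ₁ := stairLin E c.src with hφ₁
  set φ₂ := stairLin E c.tgt with hφ₂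
  have hVc1 : ‖Vc‖ ≤ 1 := norm_coe_su_le_one₅ _
  have hG₂1 : ‖G₂‖ ≤ 1 := norm_coe_su_le_one₅ _
  have hφ₁ : ‖φ₁‖ ≤ m * s := norm_stairLin_le hE s0 c.src
  have hφ₂ : ‖φ₂‖ ≤ m * s := norm_stairLin_le hE s0 c.tgt
  have hact : ((GaugeField.gaugeAct (legGauge E) V c : Matrix.specialUnitaryGroup n ℂ) : Matrix n n ℂ) = G₁ * Vc * G₂ := by
    show (((legGauge E c.src * V c * (legGauge E c.tgt)⁻¹ : Matrix.specialUnitaryGroup n ℂ)) : Matrix n n ℂ) = _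
    rw [Submonoid.coe_mul, Submonoid.coe_mul]
  -- the gauge transform to first order
  have hgauge : ‖G₁ * Vc * G₂ - (Vc + φ₁ * Vc - Vc * φ₂)‖ ≤ 19 * (m * s) ^ 2 := by
    have key : G₁ * Vc * G₂ - (Vc + φ₁ * Vc - Vc * φ₂) =
        (G₁ - 1 - φ₁) * Vc * G₂ + (1 + φ₁) * Vc * (G₂ - 1 + φ₂) - φ₁ * Vc * φ₂ := by noncomm_ring
    rw [key]
    have h1φ : ‖1 + φ₁‖ ≤ 2 := by
      calc ‖1 + φ₁‖ ≤ ‖(1 : Matrix n n ℂ)‖ + ‖φ₁‖ := norm_add_le _ _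
        _ ≤ 1 + m * s := add_le_add (by simp) hφ₁
        _ ≤ 2 := by nlinarith
    have e1 : ‖(G₁ - 1 - φ₁) * Vc * G₂‖ ≤ 6 * (m * s) ^ 2 := by
      calc _ ≤ ‖G₁ - 1 - φ₁‖ * ‖Vc‖ * ‖G₂‖ := (norm_mul_le _ _).trans (mul_le_mul_of_nonneg_right (norm_mul_le _ _) (norm_nonneg _))
        _ ≤ 6 * (m * s) ^ 2 * 1 * 1 := by gcongr
        _ = 6 * (m * s) ^ 2 := by ring
    have e2 : ‖(1 + φ₁) * Vc * (G₂ - 1 + φ₂)‖ ≤ 2 * (6 * (m * s) ^ 2) := by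
      calc _ ≤ ‖1 + φ₁‖ * ‖Vc‖ * ‖G₂ - 1 + φ₂‖ := (norm_mul_le _ _).trans (mul_le_mul_of_nonneg_right (norm_mul_le _ _) (norm_nonneg _))
        _ ≤ 2 * 1 * (6 * (m * s) ^ 2) := by gcongr
        _ = 2 * (6 * (m * s) ^ 2) := by ring
    have e3 : ‖φ₁ * Vc * φ₂‖ ≤ (m * s) * (m * s) := by
      calc _ ≤ ‖φ₁‖ * ‖Vc‖ * ‖φ₂‖ := (norm_mul_le _ _).trans (mul_le_mul_of_nonneg_right (norm_mul_le _ _) (norm_nonneg _))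
        _ ≤ (m * s) * 1 * (m * s) := by gcongr
        _ = (m * s) * (m * s) := by ring
    calc _ ≤ ‖(G₁ - 1 - φ₁) * Vc * G₂‖ + ‖(1 + φ₁) * Vc * (G₂ - 1 + φ₂)‖ + ‖φ₁ * Vc * φ₂‖ := norm_sub_le_of_le (norm_add_le _ _) le_rfl
      _ ≤ 6 * (m * s) ^ 2 + 2 * (6 * (m * s) ^ 2) + (m * s) * (m * s) := by gcongr
      _ = 19 * (m * s) ^ 2 := by ring
  -- the split identities turn `inLin·V + V·outLin` into `φ₁·V − V·φ₂ + (rowIn·V + V·rowOut)`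
  have hsplit : Vc + inLin E c * Vc + Vc * outLin E c =
      (Vc + φ₁ * Vc - Vc * φ₂) + (rowInLin E c * Vc + Vc * rowOutLin E c) := by
    rw [inLin_eq, outLin_eq hj]
    noncomm_ring
  have e : ((avgFun (expMeanLogSU (n := n)) (mulField E (faceSec V)) c : Matrix.specialUnitaryGroup n ℂ) : Matrix n n ℂ) -
      G₁ * Vc * G₂ - (rowInLin E c * Vc + Vc * rowOutLin E c) =
      (((avgFun (expMeanLogSU (n := n)) (mulField E (faceSec V)) c : Matrix.specialUnitaryGroup n ℂ) : Matrix n n ℂ) -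
        (Vc + inLin E c * Vc + Vc * outLin E c)) - (G₁ * Vc * G₂ - (Vc + φ₁ * Vc - Vc * φ₂)) := by
    rw [hsplit]; abel
  rw [hact, e]
  calc _ ≤ ‖((avgFun (expMeanLogSU (n := n)) (mulField E (faceSec V)) c : Matrix.specialUnitaryGroup n ℂ) : Matrix n n ℂ) -
          (Vc + inLin E c * Vc + Vc * outLin E c)‖ + ‖G₁ * Vc * G₂ - (Vc + φ₁ * Vc - Vc * φ₂)‖ := norm_sub_le _ _
    _ ≤ 458 * (m * s) ^ 2 + 19 * (m * s) ^ 2 := add_le_add hlegs hgauge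
    _ = 477 * (m * s) ^ 2 := by ring

end Gauge

/-! ## §2 `ApproxLiftStep` from legs (`SU(2)`) -/

section Step

/-- **`ApproxLiftStep` FROM A CORRECTION RECIPE WITH SMALL LINE FUNCTIONAL** (`SU(2)`, standing range): if to every `δ`-small coarse `V` a fine
correction `E_V` is assigned with (i) `PlaqSmall (κ₀δ) (E_V · faceSec V)`, (ii) `dist1 (E_V b) ≤ s`, `80ms ≤ 1` (`m = (d+3)L`), and (iii) line
functional `‖rowInLin E_V c · V(c) + V(c) · rowOutLin E_V c‖ ≤ η′` at every coarse bond, then `ApproxLiftStep P j κ₀ (477(ms)² + η′) δ` — the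
coarse gauge transformation `g_{E_V}` being removed by `approxLiftStep_of_gauge`. -/
theorem approxLiftStep_of_legs (hj : j + 1 ≤ P.m + P.K) {κ₀ η' δ s : ℝ}
    (Ecorr : GaugeField P (j + 1) (Matrix.specialUnitaryGroup (Fin 2) ℂ) → GaugeField P j (Matrix.specialUnitaryGroup (Fin 2) ℂ))
    (hplaq : ∀ V, PlaqSmall δ V → PlaqSmall (κ₀ * δ) (mulField (Ecorr V) (faceSec V)))
    (hE : ∀ V, PlaqSmall δ V → ∀ b, dist1 (Ecorr V b) ≤ s) (hsm : 80 * (legLen P : ℝ) * s ≤ 1)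
    (hline : ∀ V, PlaqSmall δ V → ∀ c : PBond P (j + 1),
      ‖rowInLin (Ecorr V) c * ((V c : Matrix.specialUnitaryGroup (Fin 2) ℂ) : Matrix (Fin 2) (Fin 2) ℂ) +
          ((V c : Matrix.specialUnitaryGroup (Fin 2) ℂ) : Matrix (Fin 2) (Fin 2) ℂ) * rowOutLin (Ecorr V) c‖ ≤ η') :
    ApproxLiftStep P j κ₀ (477 * ((legLen P : ℝ) * s) ^ 2 + η') δ := by
  refine approxLiftStep_of_gauge hj fun V hV => ⟨mulField (Ecorr V) (faceSec V), legGauge (Ecorr V), hplaq V hV, fun c => ?_⟩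
  have m1 : (1 : ℝ) ≤ legLen P := by
    have : 1 ≤ legLen P := le_trans P.L_pos (Nat.le_mul_of_pos_left _ (by omega))
    exact_mod_cast this
  have s0 : 0 ≤ s := (GaugeGroup.dist1_nonneg _).trans (hE V hV ⟨emb c.src, c.dir⟩)
  have hδN : 8 * (legLen P : ℝ) * s < deltaSU (Fin 2) := by linarith [one_tenth_lt_deltaSU_two, mul_nonneg (Nat.cast_nonneg (legLen P)) s0]
  have hπ : Fintype.card (Fin 2) * s < Real.pi := by
    rw [Fintype.card_fin]; push_cast; nlinarith [Real.pi_gt_three]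
  have h := norm_avgFun_mulField_faceSec_sub_gauge_sub_line_le hj (hE V hV) hsm hδN hπ V c
  unfold MiddleBondRepair.mdist
  rw [norm_sub_rev]
  have e : ((avgFun (expMeanLogSU (n := Fin 2)) (mulField (Ecorr V) (faceSec V)) c : Matrix.specialUnitaryGroup (Fin 2) ℂ) :
        Matrix (Fin 2) (Fin 2) ℂ) -
      ((GaugeField.gaugeAct (legGauge (Ecorr V)) V c : Matrix.specialUnitaryGroup (Fin 2) ℂ) : Matrix (Fin 2) (Fin 2) ℂ) =
      (((avgFun (expMeanLogSU (n := Fin 2)) (mulField (Ecorr V) (faceSec V)) c : Matrix.specialUnitaryGroup (Fin 2) ℂ) :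
          Matrix (Fin 2) (Fin 2) ℂ) -
        ((GaugeField.gaugeAct (legGauge (Ecorr V)) V c : Matrix.specialUnitaryGroup (Fin 2) ℂ) : Matrix (Fin 2) (Fin 2) ℂ) -
        (rowInLin (Ecorr V) c * ((V c : Matrix.specialUnitaryGroup (Fin 2) ℂ) : Matrix (Fin 2) (Fin 2) ℂ) +
          ((V c : Matrix.specialUnitaryGroup (Fin 2) ℂ) : Matrix (Fin 2) (Fin 2) ℂ) * rowOutLin (Ecorr V) c)) +
      (rowInLin (Ecorr V) c * ((V c : Matrix.specialUnitaryGroup (Fin 2) ℂ) : Matrix (Fin 2) (Fin 2) ℂ) +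
        ((V c : Matrix.specialUnitaryGroup (Fin 2) ℂ) : Matrix (Fin 2) (Fin 2) ℂ) * rowOutLin (Ecorr V) c) := by abel
  rw [e]
  exact (norm_add_le _ _).trans (add_le_add h (hline V hV c))

end Step

end Summit.QuantumFields.YangMills.Theorems.ApproxLift

end
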